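import Mathlib
import Summits.ResolutionOfSingularities.ResolutionOfSingularities.Theorems.RadicialJungCleanModelsCleanProp44NearLineScheme
import HarnessLib

/-!
# Route `RadicialJung`, crux `CleanModels` (stmt-ResolutionOfSingularities-15917), line `Sketch` rev 35, stub 6 `stub_cleanProp44` (X44c):
# CLEAN-PERMISSIBILITY OF NEAR LINES, XV — the corner obstruction read on the coefficients of the near line

Seat decomp-res-hand-2 g18 (structural hand).  The corner disjunct of ✓ `cleanPermissibleAt_nearLine_or_corner_or_cross` (two clean sides `V(c_{k₁})`,
`V(c_{k₂})` through `x'`, neither containing the near line `N = (e', y')` of `y = Σ_k m_k c_k`) is made EXPLICIT in the coefficients `m` for a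
threefold point (`Fin n = {i, k₁, k₂}`): it forces `m_i ∈ 𝔪_x` (the vertex `V_i = V(c_{k₁}) ∩ V(c_{k₂}) ∩ E_x` lies on the near line) and
`m_{k₁}, m_{k₂} ∉ 𝔪_x` (the near line is not a side at `V_i`).  So a near line meets a corner obstruction only at a vertex it passes through and
only if it is not a side there — read off `(a, m)` at `x` (with the cross test, ✓ `…NearLineExplicit`, the candidate insertion points of a near
line are now completely explicit in the data at `x`).

* `sum_three_of_forall_eq` — bookkeeping: a sum over `Fin n = {i, k₁, k₂}`.
* `corner_nearLine_coefficients` — pure local algebra: `φ : 𝒪 → 𝒪'` a local map of local rings, `𝒪'` a domain, `φ(𝔪) 𝒪' = (e')`, `e' ≠ 0`;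
  `(c)` generating `𝔪`, `φ(c_{k_j}) = e' s_j` with `s_j ∈ 𝔪'`, `φ(Σ m_k c_k) = e' y'` with `(e', y')` part of a regular system of parameters, and
  `s₁, s₂ ∉ (e', y')` ⟹ `m_i ∈ 𝔪 ∧ m_{k₁} ∉ 𝔪 ∧ m_{k₂} ∉ 𝔪`.

Honest framing: OURS, elementary; a TOOL.  Nothing here proves X44c, any case of `CleanModels`, or resolution of singularities in characteristic `p`.
Setting only: [cite: CossartPiltant2008, Lemma 4.3 (5)] [cite: Matsumura1987, Thm. 14.2].
-/

noncomputable section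

set_option linter.dupNamespace false -- mandated namespace of this single-conjunct summit

open IsLocalRing
open Literature.AlgebraicGeometry.Resolution

namespace Summit.ResolutionOfSingularities.ResolutionOfSingularities.Theorems.RadicialJung.CleanModels

universe u

/-- A sum over `Fin n = {i, k₁, k₂}` (three distinct indices exhausting the type). [folklore] -/
theorem sum_three_of_forall_eq {M : Type*} [AddCommMonoid M] {n : ℕ} {i k₁ k₂ : Fin n} (hik₁ : i ≠ k₁) (hik₂ : i ≠ k₂) (hk : k₁ ≠ k₂)
    (huniv : ∀ k, k = i ∨ k = k₁ ∨ k = k₂) (f : Fin n → M) : ∑ k, f k = f i + f k₁ + f k₂ := by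
  classical
  have hU : (Finset.univ : Finset (Fin n)) = {i, k₁, k₂} := by
    ext k
    simp only [Finset.mem_univ, Finset.mem_insert, Finset.mem_singleton, true_iff]
    exact huniv k
  rw [hU, Finset.sum_insert (by simp [hik₁, hik₂]), Finset.sum_insert (by simpa using hk), Finset.sum_singleton, add_assoc]

/-- **The corner obstruction on the coefficients of the near line.**  See the module docstring. [cite: CossartPiltant2008, Lemma 4.3 (5)]
[cite: Matsumura1987, Thm. 14.2] -/
theorem corner_nearLine_coefficients {O O' : Type u} [CommRing O] [IsLocalRing O] [CommRing O'] [IsLocalRing O'] [IsDomain O']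
    (φ : O →+* O') [IsLocalHom φ] {e' : O'} (hφ𝔪 : (maximalIdeal O).map φ = Ideal.span {e'}) (he'0 : e' ≠ 0)
    {n : ℕ} (c m : Fin n → O) (hc : Ideal.span (Set.range c) = maximalIdeal O) {i k₁ k₂ : Fin n} (hik₁ : i ≠ k₁) (hik₂ : i ≠ k₂) (hk : k₁ ≠ k₂)
    (huniv : ∀ k, k = i ∨ k = k₁ ∨ k = k₂) {y' s₁ s₂ : O'} (hy : φ (∑ k, m k * c k) = e' * y') (hpair : IsRsopPart (Fin.append ![e'] ![y']))
    (hs₁ : φ (c k₁) = e' * s₁) (hs₂ : φ (c k₂) = e' * s₂) (hs₁m : s₁ ∈ maximalIdeal O') (hs₂m : s₂ ∈ maximalIdeal O')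
    (hs₁N : s₁ ∉ Ideal.span ({e', y'} : Set O')) (hs₂N : s₂ ∉ Ideal.span ({e', y'} : Set O')) :
    m i ∈ maximalIdeal O ∧ m k₁ ∉ maximalIdeal O ∧ m k₂ ∉ maximalIdeal O := by
  classical
  -- images of `𝔪` are multiples of `e'`
  have hdiv : ∀ z ∈ maximalIdeal O, ∃ r : O', φ z = e' * r := by
    intro z hz
    have h1 : φ z ∈ Ideal.span {e'} := hφ𝔪 ▸ Ideal.mem_map_of_mem φ hz
    obtain ⟨r, hr⟩ := Ideal.mem_span_singleton'.mp h1
    exact ⟨r, by rw [← hr, mul_comm]⟩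
  have hcm : ∀ k, c k ∈ maximalIdeal O := fun k => hc ▸ Ideal.subset_span ⟨k, rfl⟩
  obtain ⟨si, hsi⟩ := hdiv (c i) (hcm i)
  -- the fractions `s k` for all `k`
  let s : Fin n → O' := fun k => if k = k₁ then s₁ else if k = k₂ then s₂ else si
  have hs : ∀ k, φ (c k) = e' * s k := by
    intro k
    rcases huniv k with rfl | rfl | rfl
    · simp only [s, if_neg hik₁, if_neg hik₂]; exact hsi
    · simp only [s, if_true]; exact hs₁
    · simp only [s, if_neg hk.symm, if_true]; exact hs₂
  have hsk₁ : s k₁ = s₁ := by simp [s]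
  have hsk₂ : s k₂ = s₂ := by simp [s, hk.symm]
  have hsi' : s i = si := by simp [s, hik₁, hik₂]
  -- `s i` is a unit: `e' = Σ ρ_k φ(c_k) = e' Σ ρ_k s_k`
  have hunit : IsUnit si := by
    have h1 : e' ∈ (maximalIdeal O).map φ := hφ𝔪 ▸ Ideal.mem_span_singleton_self e'
    rw [← hc, Ideal.map_span, ← Set.range_comp] at h1
    obtain ⟨ρ, hρ⟩ := Ideal.mem_span_range_iff_exists_fun.mp h1
    have h2 : e' * ∑ k, ρ k * s k = e' * 1 := by
      rw [mul_one, Finset.mul_sum]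
      conv_rhs => rw [← hρ]
      exact Finset.sum_congr rfl fun k _ => by rw [Function.comp_apply, hs k]; ring
    have h3 := mul_left_cancel₀ he'0 h2
    rw [sum_three_of_forall_eq hik₁ hik₂ hk huniv, hsk₁, hsk₂, hsi'] at h3
    by_contra hsiu
    have h4 : ρ i * si + ρ k₁ * s₁ + ρ k₂ * s₂ ∈ maximalIdeal O' :=
      (maximalIdeal O').add_mem ((maximalIdeal O').add_mem (Ideal.mul_mem_left _ _ ((mem_maximalIdeal _).mpr hsiu))
        (Ideal.mul_mem_left _ _ hs₁m)) (Ideal.mul_mem_left _ _ hs₂m)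
    rw [h3] at h4
    exact (maximalIdeal.isMaximal O').ne_top (Ideal.eq_top_of_isUnit_mem _ h4 isUnit_one)
  -- `y' = φ(m_i) si + φ(m_{k₁}) s₁ + φ(m_{k₂}) s₂`
  have hy' : y' = φ (m i) * si + φ (m k₁) * s₁ + φ (m k₂) * s₂ := by
    apply mul_left_cancel₀ he'0
    rw [← hy, map_sum, sum_three_of_forall_eq hik₁ hik₂ hk huniv]
    simp only [map_mul]
    rw [hsi, hs₁, hs₂]; ring
  have hy'm : y' ∈ maximalIdeal O' := by
    have h1 := hpair.mem_maximalIdeal (Fin.natAdd 1 0)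
    rw [Fin.append_right] at h1
    simpa using h1
  -- (1) `m_i ∈ 𝔪`
  have hmi : m i ∈ maximalIdeal O := by
    by_contra hmi
    have hu : IsUnit (φ (m i)) := (IsLocalRing.notMem_maximalIdeal.mp hmi).map φ
    have h1 : φ (m i) * si ∈ maximalIdeal O' := by
      have h2 : φ (m i) * si = y' - φ (m k₁) * s₁ - φ (m k₂) * s₂ := by rw [hy']; ring
      rw [h2]
      exact (maximalIdeal O').sub_mem ((maximalIdeal O').sub_mem hy'm (Ideal.mul_mem_left _ _ hs₁m)) (Ideal.mul_mem_left _ _ hs₂m)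
    exact mem_nonunits_iff.mp ((mem_maximalIdeal _).mp h1) (hu.mul hunit)
  obtain ⟨ρ, hρ⟩ := hdiv (m i) hmi
  -- (2) the two coefficients are units
  have key : ∀ {k k' : Fin n} {s₀ s' : O'}, s' ∈ maximalIdeal O' → s' ∉ Ideal.span ({e', y'} : Set O') →
      y' = φ (m i) * si + φ (m k) * s₀ + φ (m k') * s' → m k ∉ maximalIdeal O := by
    intro k k' s₀ s' hs'm hs'N hyk hmk
    obtain ⟨ρ₁, hρ₁⟩ := hdiv (m k) hmk
    by_cases hu' : IsUnit (φ (m k'))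
    · obtain ⟨w, hw⟩ := hu'
      apply hs'N
      have h1 : s' = ↑w⁻¹ * (y' - e' * (ρ * si + ρ₁ * s₀)) := by
        rw [hyk, hρ, hρ₁, ← hw]
        have h2 : e' * ρ * si + e' * ρ₁ * s₀ + ↑w * s' - e' * (ρ * si + ρ₁ * s₀) = ↑w * s' := by ring
        rw [h2, ← mul_assoc, Units.inv_mul, one_mul]
      rw [h1]
      exact Ideal.mul_mem_left _ _ (Ideal.sub_mem _ (Ideal.subset_span (by simp)) (Ideal.mul_mem_right _ _ (Ideal.subset_span (by simp))))
    · apply append_right_not_mem_span_sup_sq hpair 0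
      have hr : Set.range ![e'] = {e'} := by
        ext t; simp
      simp only [Matrix.cons_val_fin_one, hr]
      rw [hyk, hρ, hρ₁]
      refine Ideal.add_mem _ (Ideal.mem_sup_left ?_) (Ideal.mem_sup_right ?_)
      · have h3 : e' * ρ * si + e' * ρ₁ * s₀ = e' * (ρ * si + ρ₁ * s₀) := by ring
        rw [h3]
        exact Ideal.mul_mem_right _ _ (Ideal.mem_span_singleton_self _)
      · rw [pow_two]
        exact Ideal.mul_mem_mul ((mem_maximalIdeal _).mpr hu') hs'm
  have hy'' : y' = φ (m i) * si + φ (m k₂) * s₂ + φ (m k₁) * s₁ := by rw [hy']; ring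
  exact ⟨hmi, key (k := k₁) (k' := k₂) (s₀ := s₁) hs₂m hs₂N hy', key (k := k₂) (k' := k₁) (s₀ := s₂) hs₁m hs₁N hy''⟩

end Summit.ResolutionOfSingularities.ResolutionOfSingularities.Theorems.RadicialJung.CleanModels

end
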